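import Literature.Computability.Cryptography.StatisticalDistanceMixtures
import HarnessLib

/-!
# Iterating a Markov kernel: the union bound over the steps of an adaptive loop

Topic `Probability/Distributions`; theorems only. For a kernel `step : σ → PMF σ` on a state space and
a set `G` of good states that each step leaves with probability at most `η` (from any good state),
`T` steps started from a law `μ` end outside `G` with probability at most `μ(Gᶜ) + T·η`. This is the
probability bookkeeping of every "iterate an oracle-driven improvement step polynomially many times"
reduction whose per-step failure is small — e.g. Micciancio–Regev 2007, Lemma 5.10 (`GIVP → IncGDD`:
"we then replace `sᵢ` with `u` and repeat the process … this procedure terminates after a polynomial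
number of steps", run with a probabilistic `IncGDD` solver amplified to per-call failure `η`, inside
Cor. 5.13) — with the loop written as the `T`-fold iterate `(· ≫= step)^[T] μ` of Mathlib's
`Nat.iterate` (no new definition; a terminated run is modelled by `step` fixing terminal states).

* `PMF.toReal_toOuterMeasure_bind_compl_le` — one step: `Pr_{μ ≫= step}[Gᶜ] ≤ Pr_μ[Gᶜ] + η`;
* `PMF.toReal_toOuterMeasure_iterate_compl_le` — `T` steps: `Pr[Gᶜ after T steps] ≤ Pr_μ[Gᶜ] + T·η`;
  from a good Dirac start, `≤ T·η` (`…_pure_le`).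

## References

* W. Feller, *An Introduction to Probability Theory and Its Applications I*, 3rd ed., Wiley 1968,
  Ch. XV §1 (Markov chains: transition probabilities and their iteration) [folklore].
* D. Micciancio, O. Regev, *Worst-case to average-case reductions based on Gaussian measures*,
  SIAM J. Comput. 37 (2007) 267–302, Lemma 5.10 and Cor. 5.13 (the consumer).
-/

noncomputable section

open scoped ENNReal

namespace PMF

variable {σ : Type*}

/-- **One step of the loop**: if every good state leaves `G` with probability `≤ η` (`0 ≤ η`), then
`Pr_{μ ≫= step}[Gᶜ] ≤ Pr_μ[Gᶜ] + η` (bad states contribute at most their mass, good ones at most `η`).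
[folklore] -/
theorem toReal_toOuterMeasure_bind_compl_le (step : σ → PMF σ) (G : Set σ) {η : ℝ} (hη : 0 ≤ η)
    (hstep : ∀ s ∈ G, ((step s).toOuterMeasure Gᶜ).toReal ≤ η) (μ : PMF σ) :
    ((μ.bind step).toOuterMeasure Gᶜ).toReal ≤ (μ.toOuterMeasure Gᶜ).toReal + η := by
  classical
  rw [toReal_toOuterMeasure_bind_apply, toReal_toOuterMeasure_apply]
  have hs : Summable fun s => (μ s).toReal * ((step s).toOuterMeasure Gᶜ).toReal :=
    summable_toReal_mul_of_abs_le_one μ fun s => by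
      rw [abs_of_nonneg ENNReal.toReal_nonneg]; exact toReal_toOuterMeasure_le_one _ _
  have hpt : ∀ s, (μ s).toReal * ((step s).toOuterMeasure Gᶜ).toReal ≤
      Gᶜ.indicator (fun s => (μ s).toReal) s + (μ s).toReal * η := by
    intro s
    by_cases hsG : s ∈ G
    · rw [Set.indicator_of_notMem (show s ∉ Gᶜ by simpa using hsG), zero_add]
      exact mul_le_mul_of_nonneg_left (hstep s hsG) ENNReal.toReal_nonneg
    · rw [Set.indicator_of_mem (show s ∈ Gᶜ from hsG)]
      have h1 : ((step s).toOuterMeasure Gᶜ).toReal ≤ 1 := toReal_toOuterMeasure_le_one _ _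
      nlinarith [ENNReal.toReal_nonneg (a := μ s), ENNReal.toReal_nonneg (a := (step s).toOuterMeasure Gᶜ)]
  have hind : Summable (Gᶜ.indicator fun s => (μ s).toReal) := (summable_coe_toReal μ).indicator _
  have hη' : Summable fun s => (μ s).toReal * η := (summable_coe_toReal μ).mul_right _
  calc ∑' s, (μ s).toReal * ((step s).toOuterMeasure Gᶜ).toReal
      ≤ ∑' s, (Gᶜ.indicator (fun s => (μ s).toReal) s + (μ s).toReal * η) :=
        hs.tsum_le_tsum hpt (hind.add hη')
    _ = ∑' s, Gᶜ.indicator (fun s => (μ s).toReal) s + η := by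
        rw [hind.tsum_add hη', tsum_mul_right, tsum_coe_toReal, one_mul]

/-- **`T` steps of the loop (union bound over the steps)**: under the same hypothesis,
`Pr[state ∉ G after T steps from μ] ≤ Pr_μ[Gᶜ] + T·η`, the loop being the iterate `(· ≫= step)^[T] μ`.
[cite: MicciancioRegev2007, Lemma 5.10 (proof: "terminates after a polynomial number of steps") with Cor. 5.13] -/
theorem toReal_toOuterMeasure_iterate_compl_le (step : σ → PMF σ) (G : Set σ) {η : ℝ} (hη : 0 ≤ η)
    (hstep : ∀ s ∈ G, ((step s).toOuterMeasure Gᶜ).toReal ≤ η) :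
    ∀ (T : ℕ) (μ : PMF σ),
      (((fun ν : PMF σ => ν.bind step)^[T] μ).toOuterMeasure Gᶜ).toReal ≤
        (μ.toOuterMeasure Gᶜ).toReal + T * η
  | 0, μ => by simp
  | T + 1, μ => by
    rw [Function.iterate_succ_apply]
    refine (toReal_toOuterMeasure_iterate_compl_le step G hη hstep T (μ.bind step)).trans ?_
    have h := toReal_toOuterMeasure_bind_compl_le step G hη hstep μ
    push_cast
    linarith

/-- **From a good start**: `Pr[state ∉ G after T steps from a good state s₀] ≤ T·η`. [folklore] -/
theorem toReal_toOuterMeasure_iterate_compl_pure_le (step : σ → PMF σ) (G : Set σ) {η : ℝ}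
    (hη : 0 ≤ η) (hstep : ∀ s ∈ G, ((step s).toOuterMeasure Gᶜ).toReal ≤ η) (T : ℕ) {s₀ : σ}
    (hs₀ : s₀ ∈ G) :
    (((fun ν : PMF σ => ν.bind step)^[T] (PMF.pure s₀)).toOuterMeasure Gᶜ).toReal ≤ T * η := by
  have h := toReal_toOuterMeasure_iterate_compl_le step G hη hstep T (PMF.pure s₀)
  rwa [PMF.toOuterMeasure_pure_apply, if_neg (show s₀ ∉ Gᶜ by simpa using hs₀), ENNReal.toReal_zero,
    zero_add] at h

end PMF

end
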